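import Summits.CriticalPhenomena.CardyFormulaZ2.Theorems.CardyComplexConeParafermionToSLESixFamiliesDiamondTraceWiredCore
import Summits.CriticalPhenomena.CardyFormulaZ2.Theorems.CardyComplexConeParafermionToSLESixFamiliesDiamondIdentifyTouchMass
import HarnessLib

/-!
# (DIR) and (LOW) at one mesh along one side, from the chart hypotheses (line `potential-darboux-picard-diamond`,
# S1‴ assembly: side cells → chain cells → chain sum → ray distance / touch mass)

Crux `ParafermionToSLESixFamilies` (stmt-CriticalPhenomena-11389), line `potential-darboux-picard-diamond`, stub
`stub_exactPotentialTracePh3` (S1‴). This file proves the two metric clauses of `ExactPotentialTracePh` for ONE admissible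
datum `E` and ONE oriented boundary segment `[p, q]` of a side of the tilted rectangle, given the chart of the side
(`…DiamondTraceSideChart`, `…TraceLayers`) and, on the window `[Yp + η/4, Yq − η/4]` of ordinates, the two hypotheses the
assembly receives eventually in the mesh ((ARC): which arc the boundary layers belong to; (PHASE): the passage phase at the
first boundary dart of every touch site / tip cell is `d · conj(iʲ e^{∓iπ/6})`, `d = u δ · τ(p,q)`), plus (H1)/(H2) on free
sides:

* `sideCell_chart` — a side cell `f ∈ sideCells E δ p q η` is an inner face with centre abscissa within `3δ` of the side
  line, ordinate in `[Yp + η − 6δ, Yq − η + 6δ]`, centre layer in `[n − 4, n − 1]`, corners in the bulk;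
* `exists_refSite` — its chain cell `faceAt x j` (`A x = n − 2`, `B x ∈ {Bc, Bc+1}`, `‖Ψ f − Ψ (faceAt x j)‖ ≤ 2`,
  `…DiamondTraceCellGap`); `refSites_ordered` — for `proj f ≤ proj f′` the two chain sites are `x`, `x − N(u_j + u_{j+1})`
  IN THIS ORDER (parity of the chart), inside the window;
* `rayDist_le_of_norm_sub_le` — `‖z − R d‖ ≤ C`, `R ≥ 0` gives `rayDist d (s z) ≤ s C`;
* `dir_low_free_of_chart` (registered, `--supports` the crux) — **(DIR) and (LOW) on a free side at one mesh**:
  `rayDist (d) (δ^{2/3}(Ψ f′ − Ψ f)) ≤ 10 δ^{2/3}` and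
  `½ · touchMass E δ p q (proj f + 3δ) (proj f′ − 3δ) − 10 δ^{2/3} ≤ re(conj d · δ^{2/3}(Ψ f′ − Ψ f))`
  (chain sum `√3 d Σ P`, two gaps of `2`, and the window's touch mass `≤ 3 Σ P ≤ (2/√3)·√3 Σ P`);
* `dir_wired_of_chart` — **(DIR) on a wired side at one mesh** (`…DiamondTraceWiredCore`: error `5 + 2 + 2`).
-/

noncomputable section

namespace Summit.CriticalPhenomena.CardyFormulaZ2.Cruxes.ParafermionToSLESixFamilies.PotentialDarbouxPicardDiamond

open scoped BigOperators
open Set Metric Complex MeasureTheory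
open Literature.Probability Literature.Probability.LatticeModels Literature.Probability.Percolation
open Literature.Probability.LatticeModels.DiscreteDobrushin
open Literature.Probability.RandomPlanarGeometry
open Summit.CriticalPhenomena.CardyFormulaZ2.Cruxes.EdgePrecompact.QkzStripBoundaryArm (cornerObs)
open Summit.CriticalPhenomena.CardyFormulaZ2.Cruxes.ParafermionToSLESixFamilies.IicTraceFluxPairing
  (touchSites touchProb touchProb_nonneg touchProb_le_one)

/-! ## Ray distance from a direction estimate -/

/-- **`‖z − R·d‖ ≤ C` with `R ≥ 0` puts `s·z` within `s·C` of the ray `ℝ≥0 · d`** (`s ≥ 0`). -/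
theorem rayDist_le_of_norm_sub_le {d z : ℂ} {R C s : ℝ} (hR : 0 ≤ R) (hs : 0 ≤ s) (h : ‖z - (R : ℂ) * d‖ ≤ C) :
    rayDist d ((s : ℂ) * z) ≤ s * C := by
  unfold rayDist
  refine (infDist_le_dist_of_mem (mem_image_of_mem _ (show s * R ∈ Ici (0 : ℝ) from mul_nonneg hs hR))).trans ?_
  rw [dist_eq_norm, show (s : ℂ) * z - ((s * R : ℝ) : ℂ) * d = (s : ℂ) * (z - (R : ℂ) * d) by push_cast; ring, norm_mul,
    norm_real, Real.norm_eq_abs, abs_of_nonneg hs]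
  exact mul_le_mul_of_nonneg_left h hs

/-- The real part against a unit direction: `re(conj d · (R d + ε)) ≥ R − ‖ε‖` for `‖d‖ = 1`. -/
theorem re_conj_mul_ge {d z : ℂ} {R C : ℝ} (hd : ‖d‖ = 1) (h : ‖z - (R : ℂ) * d‖ ≤ C) :
    R - C ≤ ((starRingEnd ℂ) d * z).re := by
  have hsplit : (starRingEnd ℂ) d * z = (R : ℂ) * ((starRingEnd ℂ) d * d) + (starRingEnd ℂ) d * (z - (R : ℂ) * d) := by ring
  have hdd : (starRingEnd ℂ) d * d = 1 := by rw [mul_comm, mul_conj, normSq_eq_norm_sq, hd]; norm_num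
  rw [hsplit, hdd, mul_one, add_re, ofReal_re]
  have h1 : |((starRingEnd ℂ) d * (z - (R : ℂ) * d)).re| ≤ C :=
    (abs_re_le_norm _).trans (by rw [norm_mul, norm_conj, hd, one_mul]; exact h)
  linarith [neg_abs_le ((starRingEnd ℂ) d * (z - (R : ℂ) * d)).re]

section Side

variable {c e : ℂ} (he : ‖e‖ = 1) {α β δ : ℝ} (hδ : 0 < δ) (hα : 4 * δ ≤ α) {D : DobrushinDomain} {E : DiscreteDobrushin}
  (hΩ : E.Ω = {z : ℂ | |((z - c) * e).re| < α ∧ |((z - c) * e).im| < β}) (hΩD : E.Ω = D.carrier) (hEδ : E.δ = δ)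
  (hE : E.IsZdAdmissible) (hgood : ∀ x : Site 2, meshPoint δ x ∈ E.Ω → x ∈ meshDomain E.Ω δ)
  {j : Fin 4} {X₀ Y₀ : ℝ} (hX : ∀ x : Site 2, ((meshPoint δ x - c) * e).re = Real.sqrt 2 / 2 * δ * layerFn j x + X₀)
  (hY : ∀ x : Site 2, ((meshPoint δ x - c) * e).im = Real.sqrt 2 / 2 * δ * layerFn (j + 1) x + Y₀)
  {n : ℤ} (hn : Real.sqrt 2 / 2 * δ * n + X₀ < α) (hn' : α ≤ Real.sqrt 2 / 2 * δ * (n + 1) + X₀)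
  {p q : ℂ} {Yp Yq η : ℝ} (hpX : ((p - c) * e).re = α) (hqX : ((q - c) * e).re = α) (hpY : ((p - c) * e).im = Yp)
  (hqY : ((q - c) * e).im = Yq) (hpq : Yp < Yq) (hYp : -β ≤ Yp) (hYq : Yq ≤ β) (hη : 40 * δ ≤ η)

include hδ hX hn in
/-- A lattice site with abscissa `≥ α − 3δ` has layer `≥ n − 4`. -/
theorem le_layerFn_of_re {y : Site 2} (hre : α - 3 * δ ≤ ((meshPoint δ y - c) * e).re) : n - 4 ≤ layerFn j y := by
  rw [hX] at hre
  have hs2 : (1.4 : ℝ) < Real.sqrt 2 := by rw [Real.lt_sqrt (by norm_num)]; norm_num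
  have hs2δ : 1.4 * δ < Real.sqrt 2 * δ := mul_lt_mul_of_pos_right hs2 hδ
  by_contra hlt
  push Not at hlt
  have hle : ((layerFn j y : ℤ) : ℝ) ≤ (n : ℝ) - 5 := by exact_mod_cast (show layerFn j y ≤ n - 5 by omega)
  have hmul : Real.sqrt 2 / 2 * δ * ((layerFn j y : ℤ) : ℝ) ≤ Real.sqrt 2 / 2 * δ * ((n : ℝ) - 5) :=
    mul_le_mul_of_nonneg_left hle (by positivity)
  linarith

include he hδ hα hX hY hn hn' hpX hqX hpY hqY hpq hYp hYq hη in
/-- **A side cell in the chart**: centre abscissa within `3δ` of the side line, ordinate in `[Yp + η − 6δ, Yq − η + 6δ]`,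
centre layer `≥ n − 4`, and all corners in the bulk of the side. -/
theorem sideCell_chart {f : Site 2} (hf : f ∈ sideCells E δ p q η) :
    n - 4 ≤ layerFn j f + layerTop j - 1 ∧ Yp + η - 6 * δ ≤ ((ctr δ f - c) * e).im ∧ ((ctr δ f - c) * e).im ≤ Yq - η + 6 * δ ∧
      ∀ v : Site 2, IsCorner v f → |((meshPoint δ v - c) * e).im| + 3 * δ < β ∧ -α + 3 * δ < ((meshPoint δ v - c) * e).re := by
  obtain ⟨-, hdist, hfp, hfq⟩ := hf
  obtain ⟨hXf, hY1, hY2⟩ := tilt_bounds_of_near he hpX hqX hpY hqY hpq.le hdist hfp hfq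
  have hLc := le_centreLayer_of_re_ctr hδ hX hn (g := f) (by linarith [(abs_le.1 hXf).1])
  refine ⟨hLc, by linarith, by linarith, fun v hv => ?_⟩
  have hchart := chart_of_isCorner j hv
  have hAv : n - 6 ≤ layerFn j v := by
    have : |layerFn j v - (layerFn j f + layerTop j - 1)| ≤ 1 := by
      linarith [abs_nonneg (layerFn (j + 1) v - (layerFn (j + 1) f + layerTop (j + 1) - 1))]
    have := abs_le.1 this; omega
  have hBv : |layerFn (j + 1) v - (layerFn (j + 1) f + layerTop (j + 1) - 1)| ≤ 1 := by
    linarith [abs_nonneg (layerFn j v - (layerFn j f + layerTop j - 1))]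
  have hYv : |((meshPoint δ v - c) * e).im - ((ctr δ f - c) * e).im| ≤ δ := by
    rw [hY, im_tilt_ctr hY, abs_le]
    have hBv' := abs_le.1 hBv
    have h1' : ((layerFn (j + 1) v : ℤ) : ℝ) - (layerFn (j + 1) f + layerTop (j + 1) - 1) ≤ 1 := by exact_mod_cast hBv'.2
    have h2' : (-1 : ℝ) ≤ ((layerFn (j + 1) v : ℤ) : ℝ) - (layerFn (j + 1) f + layerTop (j + 1) - 1) := by exact_mod_cast hBv'.1
    have hpos : 0 ≤ Real.sqrt 2 / 2 * δ := by positivity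
    have hh : Real.sqrt 2 / 2 * δ ≤ δ := by
      have hs2 : Real.sqrt 2 < 1.415 := by rw [Real.sqrt_lt' (by norm_num)]; norm_num
      nlinarith
    constructor <;> nlinarith
  have hYv' := abs_le.1 hYv
  exact bulk_of_chart hδ hα hX hn' (Yl := Yp + η / 4) (Yr := Yq - η / 4) (by linarith) (by linarith) hAv (by linarith)
    (by linarith)

include he hδ hα hΩ hEδ hE hgood hX hY hn hn' hpX hqX hpY hqY hpq hYp hYq hη in
/-- **The chain cell of a side cell**: a site `x` of the chain layer with `B x ∈ {Bc, Bc + 1}`, `faceAt x j` inner,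
`‖Ψ f − Ψ (faceAt x j)‖ ≤ 2`, and ordinate `Y(ctr f) ≤ Y(δx) ≤ Y(ctr f) + δ`. -/
theorem exists_refSite {δ' : ℝ} {Φ Ψ : Site 2 → ℂ} (hP : IsExactPair E δ' Φ Ψ) {f : Site 2} (hf : f ∈ sideCells E δ p q η) :
    ∃ x : Site 2, layerFn j x = n - 2 ∧
      (layerFn (j + 1) x = layerFn (j + 1) f + layerTop (j + 1) - 1 ∨ layerFn (j + 1) x = layerFn (j + 1) f + layerTop (j + 1) - 1 + 1) ∧
      E.IsInnerFace (faceAt x j) ∧ ‖Ψ f - Ψ (faceAt x j)‖ ≤ 2 ∧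
      ((ctr δ f - c) * e).im ≤ ((meshPoint δ x - c) * e).im ∧ ((meshPoint δ x - c) * e).im ≤ ((ctr δ f - c) * e).im + δ := by
  obtain ⟨hLc, -, -, hbulk⟩ := sideCell_chart he hδ hα hX hY hn hn' hpX hqX hpY hqY hpq hYp hYq hη hf
  obtain ⟨x, hA, hB, hinner, hgap⟩ := exists_chainCell_near' he hδ hΩ hEδ hgood hX hn hn' hbulk hE hf.1.1 hLc hP
  have hh : Real.sqrt 2 / 2 * δ ≤ δ := by
    have hs2 : Real.sqrt 2 < 1.415 := by rw [Real.sqrt_lt' (by norm_num)]; norm_num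
    nlinarith
  have hpos : 0 ≤ Real.sqrt 2 / 2 * δ := by positivity
  refine ⟨x, hA, hB, hinner, hgap, ?_, ?_⟩ <;> rw [hY, im_tilt_ctr hY] <;> rcases hB with hB | hB <;> rw [hB] <;> push_cast <;>
    nlinarith

include he hδ hα hΩ hEδ hE hgood hX hY hn hn' hpX hqX hpY hqY hpq hYp hYq hη in
/-- **The chain cells of two ordered side cells are ordered along the chain**, inside the window: for side cells `f, f′`
with `proj f ≤ proj f′` there are a chain site `x` and `N` with `‖Ψ f − Ψ (faceAt x j)‖ ≤ 2`,
`‖Ψ f′ − Ψ (faceAt x_N j)‖ ≤ 2` (`x_N = x − N(u_j + u_{j+1})`), `Yp + η/4 + 3δ ≤ Y(δx)`, `Y(δ x_N) ≤ Yq − η/4 − 3δ`, and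
`Y(ctr f) ≤ Y(δx) ≤ Y(ctr f) + δ`, `Y(ctr f′) ≤ Y(δ x_N) ≤ Y(ctr f′) + δ`. -/
theorem refSites_ordered {δ' : ℝ} {Φ Ψ : Site 2 → ℂ} (hP : IsExactPair E δ' Φ Ψ) {f f' : Site 2}
    (hf : f ∈ sideCells E δ p q η) (hf' : f' ∈ sideCells E δ p q η) (hle : proj p q (ctr δ f) ≤ proj p q (ctr δ f')) :
    ∃ (x : Site 2) (N : ℕ), layerFn j x = n - 2 ∧ ‖Ψ f - Ψ (faceAt x j)‖ ≤ 2 ∧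
      ‖Ψ f' - Ψ (faceAt (x - (N : ℤ) • (cornerUnit j + cornerUnit (j + 1))) j)‖ ≤ 2 ∧
      Yp + η / 4 + 3 * δ ≤ ((meshPoint δ x - c) * e).im ∧
      ((meshPoint δ (x - (N : ℤ) • (cornerUnit j + cornerUnit (j + 1))) - c) * e).im ≤ Yq - η / 4 - 3 * δ ∧
      ((ctr δ f - c) * e).im ≤ ((meshPoint δ x - c) * e).im ∧ ((meshPoint δ x - c) * e).im ≤ ((ctr δ f - c) * e).im + δ ∧
      ((ctr δ f' - c) * e).im ≤ ((meshPoint δ (x - (N : ℤ) • (cornerUnit j + cornerUnit (j + 1))) - c) * e).im ∧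
      ((meshPoint δ (x - (N : ℤ) • (cornerUnit j + cornerUnit (j + 1))) - c) * e).im ≤ ((ctr δ f' - c) * e).im + δ := by
  obtain ⟨x, hA, hB, -, hgap, hx1, hx2⟩ := exists_refSite he hδ hα hΩ hEδ hE hgood hX hY hn hn' hpX hqX hpY hqY hpq hYp hYq hη hP hf
  obtain ⟨x', hA', hB', -, hgap', hx1', hx2'⟩ :=
    exists_refSite he hδ hα hΩ hEδ hE hgood hX hY hn hn' hpX hqX hpY hqY hpq hYp hYq hη hP hf'
  obtain ⟨-, hYf1, -, -⟩ := sideCell_chart he hδ hα hX hY hn hn' hpX hqX hpY hqY hpq hYp hYq hη hf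
  obtain ⟨-, -, hYf2', -⟩ := sideCell_chart he hδ hα hX hY hn hn' hpX hqX hpY hqY hpq hYp hYq hη hf'
  -- the centres are ordered, hence so are the chain sites (parity)
  rw [proj_eq_im_sub he hpX hqX hpY hqY hpq, proj_eq_im_sub he hpX hqX hpY hqY hpq, im_tilt_ctr hY, im_tilt_ctr hY] at hle
  have hpos : 0 < Real.sqrt 2 / 2 * δ := by positivity
  have hBc : layerFn (j + 1) f + layerTop (j + 1) - 1 ≤ layerFn (j + 1) f' + layerTop (j + 1) - 1 := by
    have : ((layerFn (j + 1) f + layerTop (j + 1) - 1 : ℤ) : ℝ) ≤ ((layerFn (j + 1) f' + layerTop (j + 1) - 1 : ℤ) : ℝ) := by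
      push_cast; nlinarith
    exact_mod_cast this
  obtain ⟨m, hm⟩ := layerFn_add_layerFn_succ_even j x
  obtain ⟨m', hm'⟩ := layerFn_add_layerFn_succ_even j x'
  have hBB : layerFn (j + 1) x ≤ layerFn (j + 1) x' := by rcases hB with hB | hB <;> rcases hB' with hB' | hB' <;> omega
  obtain ⟨N, hN⟩ : ∃ N : ℕ, layerFn (j + 1) x' = layerFn (j + 1) x + 2 * N := ⟨(m' - m).toNat, by omega⟩
  have hx' : x' = x - (N : ℤ) • (cornerUnit j + cornerUnit (j + 1)) := eq_chainSite_of_layerFn j (by rw [hA', hA]) hN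
  refine ⟨x, N, hA, hgap, by rw [← hx']; exact hgap', by linarith, by rw [← hx']; linarith, hx1, hx2, by rw [← hx']; exact hx1',
    by rw [← hx']; exact hx2'⟩

/-! ## (DIR) and (LOW) on a free side -/

include he hδ hα hΩ hEδ hE hgood hX hY hn hn' hpX hqX hpY hqY hpq hYp hYq hη in
/-- **(DIR) and (LOW) on a free side at one mesh.** Under (ARC, free) and (PHASE, free touch darts, unit `d`) on the window
`[Yp + η/4, Yq − η/4]` and (H1)/(H2): for every exact pair of `E` at mesh `δ` and side cells `f, f′` of `[p, q]` (trim `η`)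
with `proj f ≤ proj f′`: `rayDist d (δ^{2/3}(Ψ f′ − Ψ f)) ≤ 10 δ^{2/3}` and
`½ touchMass E δ p q (proj f + 3δ) (proj f′ − 3δ) − 10 δ^{2/3} ≤ re(conj d · δ^{2/3}(Ψ f′ − Ψ f))`. -/
theorem dir_low_free_of_chart'
    (hArc : ∀ x : Site 2, n - 4 ≤ layerFn j x → layerFn j x ≤ n → Yp + η / 4 ≤ ((meshPoint δ x - c) * e).im →
      ((meshPoint δ x - c) * e).im ≤ Yq - η / 4 → x ∉ E.zdArcA ∧ (x ∈ E.zdBoundary → x ∈ E.zdArcB))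
    {d : ℂ} (hd : ‖d‖ = 1)
    (hPh : ∀ x : Site 2, layerFn j x = n - 2 → Yp + η / 4 ≤ ((meshPoint δ x - c) * e).im →
      ((meshPoint δ x - c) * e).im ≤ Yq - η / 4 → E.IsInnerFace (faceAt x j) → x ∉ E.zdArcB →
      x + cornerUnit (j + 1) ∈ E.zdArcB → x + cornerUnit (j + 2) ∈ E.zdArcB →
      ∀ (ω : BondConfig (Site 2)) (t : ℕ), t < exitTime hE ω → cornerOrbit (E.bcBondConfig ω) (startCorner hE) t = (x, j) →
        Complex.exp (-(Real.pi / 6 * turnCount (E.bcBondConfig ω) (startCorner hE) t : ℝ) * I) * I ^ (j : ℕ) *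
          Complex.exp (((-(Real.pi / 6) : ℝ) : ℂ) * I) = d)
    (hA1 : ((discreteDomainGraph E.Ω E.δ).induce E.zdArcA).Preconnected) (hB1 : ((zdGraph 2).induce E.zdArcB).Preconnected)
    {Φ Ψ : Site 2 → ℂ} (hP : IsExactPair E δ Φ Ψ) {f f' : Site 2} (hf : f ∈ sideCells E δ p q η)
    (hf' : f' ∈ sideCells E δ p q η) (hle : proj p q (ctr δ f) ≤ proj p q (ctr δ f')) :
    rayDist d ((((δ ^ ((2:ℝ) / 3) : ℝ) : ℂ)) * (Ψ f' - Ψ f)) ≤ 10 * δ ^ ((2:ℝ) / 3) ∧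
      1 / 2 * touchMass E δ p q (proj p q (ctr δ f) + 3 * δ) (proj p q (ctr δ f') - 3 * δ) - 10 * δ ^ ((2:ℝ) / 3) ≤
        ((starRingEnd ℂ) d * ((((δ ^ ((2:ℝ) / 3) : ℝ) : ℂ)) * (Ψ f' - Ψ f))).re := by
  have hYl : -β + 3 * δ < Yp + η / 4 := by linarith
  have hYr : Yq - η / 4 + 3 * δ < β := by linarith
  have hP' : IsExactPair E E.δ Φ Ψ := by rw [hEδ]; exact hP
  obtain ⟨x, N, hA, hgap, hgap', hx1, hx2, hxf, hxf2, hxf', hxf2'⟩ :=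
    refSites_ordered he hδ hα hΩ hEδ hE hgood hX hY hn hn' hpX hqX hpY hqY hpq hYp hYq hη hP hf hf' hle
  have hchain := free_chainSum_of_chart he hδ hα hΩ hEδ hE hgood hX hY hn hn' hYl hYr hArc hPh hA1 hB1 hP' hA
    (by linarith) N (by linarith)
  set S : ℝ := ∑ i ∈ Finset.range N, touchProb E (x - (i : ℤ) • (cornerUnit j + cornerUnit (j + 1))) with hS
  have hS0 : 0 ≤ S := Finset.sum_nonneg fun i _ => touchProb_nonneg E _
  have hR : Ψ (faceAt (x - (N : ℤ) • (cornerUnit j + cornerUnit (j + 1))) j) - Ψ (faceAt x j) = ((Real.sqrt 3 * S : ℝ) : ℂ) * d := by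
    rw [hchain, hS]; push_cast; ring
  -- the direction estimate with error `9`
  have herr : ‖Ψ f' - Ψ f - ((Real.sqrt 3 * S : ℝ) : ℂ) * d‖ ≤ 9 := by
    have hdecomp : Ψ f' - Ψ f - ((Real.sqrt 3 * S : ℝ) : ℂ) * d =
        (Ψ f' - Ψ (faceAt (x - (N : ℤ) • (cornerUnit j + cornerUnit (j + 1))) j)) +
          (Ψ (faceAt (x - (N : ℤ) • (cornerUnit j + cornerUnit (j + 1))) j) - Ψ (faceAt x j) - ((Real.sqrt 3 * S : ℝ) : ℂ) * d) -
          (Ψ f - Ψ (faceAt x j)) := by ring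
    rw [hdecomp, hR, sub_self, add_zero]
    exact (norm_sub_le _ _).trans (by linarith)
  have hδ23 : 0 ≤ δ ^ ((2:ℝ) / 3) := Real.rpow_nonneg hδ.le _
  refine ⟨(rayDist_le_of_norm_sub_le (by positivity) hδ23 herr).trans (by nlinarith), ?_⟩
  -- (LOW): the window's touch mass against the chain sum
  have hre := re_conj_mul_ge hd herr
  have hW : touchMass E δ p q (proj p q (ctr δ f) + 3 * δ) (proj p q (ctr δ f') - 3 * δ) ≤ δ ^ ((2:ℝ) / 3) * (3 * S) := by
    unfold touchMass
    refine mul_le_mul_of_nonneg_left ?_ hδ23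
    set W : Set (Site 2) := {y ∈ touchSites E | infDist (meshPoint δ y) (segment ℝ p q) ≤ 3 * δ ∧
      proj p q (ctr δ f) + 3 * δ ≤ proj p q (meshPoint δ y) ∧ proj p q (meshPoint δ y) ≤ proj p q (ctr δ f') - 3 * δ} with hWdef
    have hWfin : W.Finite := (finite_near_segment hδ p q).subset fun y hy => hy.2.1
    have hsum : ∑ᶠ y, W.indicator (touchProb E) y = ∑ y ∈ hWfin.toFinset, touchProb E y := by
      rw [finsum_eq_sum_of_support_subset _ (s := hWfin.toFinset)
        (fun y hy => by exact Finset.mem_coe.2 (hWfin.mem_toFinset.2 (support_indicator_subset hy)))]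
      exact Finset.sum_congr rfl fun y hy => indicator_of_mem (hWfin.mem_toFinset.1 hy) _
    rw [hsum, hS]
    refine sum_touchProb_window_le' he hδ hα hΩ hEδ hE hgood hX hY hn hn' hYl hYr hA (by linarith) N (by linarith) _
      fun y hy => ?_
    obtain ⟨hyt, hyd, hy1, hy2⟩ := hWfin.mem_toFinset.1 hy
    rw [proj_eq_im_sub he hpX hqX hpY hqY hpq, proj_eq_im_sub he hpX hqX hpY hqY hpq] at hy1 hy2
    obtain ⟨hXy, -, -⟩ := tilt_bounds_of_infDist_le he hpX hqX hpY hqY hpq.le hyd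
    have hh : Real.sqrt 2 / 2 * δ ≤ δ := by
      have hs2 : Real.sqrt 2 < 1.415 := by rw [Real.sqrt_lt' (by norm_num)]; norm_num
      nlinarith
    exact ⟨hyt, le_layerFn_of_re hδ hX hn (by linarith [(abs_le.1 hXy).1]), by linarith, by linarith⟩
  have hs3 : (3 : ℝ) / 2 ≤ Real.sqrt 3 := by rw [Real.le_sqrt (by norm_num) (by norm_num)]; norm_num
  have hSδ : 0 ≤ S * δ ^ ((2:ℝ) / 3) := mul_nonneg hS0 hδ23
  have h2 : (3 / 2 : ℝ) * (S * δ ^ ((2:ℝ) / 3)) ≤ Real.sqrt 3 * (S * δ ^ ((2:ℝ) / 3)) := mul_le_mul_of_nonneg_right hs3 hSδ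
  have hmain : 1 / 2 * touchMass E δ p q (proj p q (ctr δ f) + 3 * δ) (proj p q (ctr δ f') - 3 * δ) ≤
      δ ^ ((2:ℝ) / 3) * (Real.sqrt 3 * S) := by linarith
  rw [show (starRingEnd ℂ) d * ((((δ ^ ((2:ℝ) / 3) : ℝ) : ℂ)) * (Ψ f' - Ψ f)) =
      (((δ ^ ((2:ℝ) / 3) : ℝ) : ℂ)) * ((starRingEnd ℂ) d * (Ψ f' - Ψ f)) by ring, re_ofReal_mul]
  nlinarith [mul_le_mul_of_nonneg_left hre hδ23]

/-! ## (DIR) on a wired side -/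

include he hδ hα hΩ hΩD hEδ hE hgood hX hY hn hn' hpX hqX hpY hqY hpq hYp hYq hη in
/-- **(DIR) on a wired side at one mesh.** Under (ARC, wired) and (PHASE, first tip darts, unit `d`) on the window: for every
exact pair of `E` at mesh `δ` and side cells `f, f′` with `proj f ≤ proj f′`, `rayDist d (δ^{2/3}(Ψ f′ − Ψ f)) ≤ 10 δ^{2/3}`. -/
theorem dir_wired_of_chart
    (hArcW : ∀ x : Site 2, n - 4 ≤ layerFn j x → layerFn j x ≤ n → Yp + η / 4 ≤ ((meshPoint δ x - c) * e).im →
      ((meshPoint δ x - c) * e).im ≤ Yq - η / 4 → x ∉ E.zdArcB ∧ (x ∈ E.zdBoundary → x ∈ E.zdArcA))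
    {d : ℂ} (hd : ‖d‖ = 1)
    (hPhW : ∀ a : Site 2, layerFn j a = n - 1 → Yp + η / 4 ≤ ((meshPoint δ a - c) * e).im →
      ((meshPoint δ a - c) * e).im ≤ Yq - η / 4 → E.IsInnerFace (faceAt a j) → a ∈ E.zdArcA →
      a + cornerUnit (j + 1) ∈ E.zdArcA → a + cornerUnit (j + 2) ∈ E.zdArcA →
      ∀ (ω : BondConfig (Site 2)) (t : ℕ), t < exitTime hE ω → cornerOrbit (E.bcBondConfig ω) (startCorner hE) t = (a, j) →
        Complex.exp (-(Real.pi / 6 * turnCount (E.bcBondConfig ω) (startCorner hE) t : ℝ) * I) * I ^ (j : ℕ) *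
          Complex.exp (((Real.pi / 6 : ℝ)) * I) = d)
    {Φ Ψ : Site 2 → ℂ} (hP : IsExactPair E δ Φ Ψ) {f f' : Site 2} (hf : f ∈ sideCells E δ p q η)
    (hf' : f' ∈ sideCells E δ p q η) (hle : proj p q (ctr δ f) ≤ proj p q (ctr δ f')) :
    rayDist d ((((δ ^ ((2:ℝ) / 3) : ℝ) : ℂ)) * (Ψ f' - Ψ f)) ≤ 10 * δ ^ ((2:ℝ) / 3) := by
  have hYl : -β + 3 * δ < Yp + η / 4 := by linarith
  have hYr : Yq - η / 4 + 3 * δ < β := by linarith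
  have hP' : IsExactPair E E.δ Φ Ψ := by rw [hEδ]; exact hP
  obtain ⟨x, N, hA, hgap, hgap', hx1, hx2, -, -, -, -⟩ :=
    refSites_ordered he hδ hα hΩ hEδ hE hgood hX hY hn hn' hpX hqX hpY hqY hpq hYp hYq hη hP hf hf' hle
  obtain ⟨R, hR0, hR⟩ := wired_chainSum_of_chart' he hδ hα hΩ hΩD hEδ hE hgood hX hY hn hn' hYl hYr hArcW hd hPhW hP' hA
    hx1 N hx2
  have herr : ‖Ψ f' - Ψ f - (R : ℂ) * d‖ ≤ 9 := by
    have hdecomp : Ψ f' - Ψ f - (R : ℂ) * d =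
        (Ψ f' - Ψ (faceAt (x - (N : ℤ) • (cornerUnit j + cornerUnit (j + 1))) j)) +
          (Ψ (faceAt (x - (N : ℤ) • (cornerUnit j + cornerUnit (j + 1))) j) - Ψ (faceAt x j) - (R : ℂ) * d) -
          (Ψ f - Ψ (faceAt x j)) := by ring
    rw [hdecomp]
    refine (norm_sub_le _ _).trans ?_
    refine (add_le_add (norm_add_le _ _) le_rfl).trans ?_
    linarith
  have hδ23 : 0 ≤ δ ^ ((2:ℝ) / 3) := Real.rpow_nonneg hδ.le _
  exact (rayDist_le_of_norm_sub_le hR0 hδ23 herr).trans (by nlinarith)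

end Side

/-- **(DIR) and (LOW) on a free side at one mesh, from the chart hypotheses** (registered helper of
`stub_exactPotentialTracePh3`). For admissible data `E` on the open tilted rectangle of a side frame `e` (`‖e‖ = 1`, across
half-width `α ≥ 4δ`, along half-length `β`) read at its mesh `δ > 0`, every lattice point of the rectangle in `Ω_δ`, chart
`(δ/√2)·layerFn j + X₀` / `(δ/√2)·layerFn (j+1) + Y₀`, last inside layer `n`; two points `p, q` of the side line `re = α` with
ordinates `Yp < Yq` in `[−β, β]` and a trim `η ≥ 40δ`; (ARC, free) and (PHASE, free touch darts, unit `d`) on the window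
`[Yp + η/4, Yq − η/4]`; (H1)/(H2): then for every exact pair at mesh `δ` and side cells `f, f′` of `[p, q]` (trim `η`) with
`proj f ≤ proj f′`, `rayDist d (δ^{2/3}(Ψ f′ − Ψ f)) ≤ 10 δ^{2/3}` and
`½ touchMass E δ p q (proj f + 3δ) (proj f′ − 3δ) − 10 δ^{2/3} ≤ re(conj d · δ^{2/3}(Ψ f′ − Ψ f))`. -/
theorem dir_low_free_of_chart : ∀ (c e : ℂ), ‖e‖ = 1 → ∀ (α β δ : ℝ), 0 < δ → 4 * δ ≤ α → ∀ (E : DiscreteDobrushin), E.Ω = {z : ℂ | |((z - c) * e).re| < α ∧ |((z - c) * e).im| < β} → E.δ = δ → ∀ (hE : E.IsZdAdmissible), (∀ x : Site 2, meshPoint δ x ∈ E.Ω → x ∈ meshDomain E.Ω δ) → ∀ (j : Fin 4) (X₀ Y₀ : ℝ), (∀ x : Site 2, ((meshPoint δ x - c) * e).re = Real.sqrt 2 / 2 * δ * layerFn j x + X₀) → (∀ x : Site 2, ((meshPoint δ x - c) * e).im = Real.sqrt 2 / 2 * δ * layerFn (j + 1) x + Y₀) → ∀ (n : ℤ), Real.sqrt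 2 / 2 * δ * n + X₀ < α → α ≤ Real.sqrt 2 / 2 * δ * (n + 1) + X₀ → ∀ (p q : ℂ) (Yp Yq η : ℝ), ((p - c) * e).re = α → ((q - c) * e).re = α → ((p - c) * e).im = Yp → ((q - c) * e).im = Yq → Yp < Yq → -β ≤ Yp → Yq ≤ β → 40 * δ ≤ η → (∀ x : Site 2, n - 4 ≤ layerFn j x → layerFn j x ≤ n → Yp + η / 4 ≤ ((meshPoint δ x - c) * e).im → ((meshPoint δ x - c) * e).im ≤ Yq - η / 4 → x ∉ E.zdArcA ∧ (x ∈ E.zdBoundary → x ∈ E.zdArcB)) → ∀ (d : ℂ), ‖d‖ = 1 → (∀ x : Site 2, layerFn j x = n - 2 → Yp + η / 4 ≤ ((meshPoint δ x - c) * e).im → ((meshPoint δ x - c) * e).im ≤ Yq - η / 4 → E.IsInnerFace (faceAt x j) → x ∉ E.zdArcB → x + cornerUnit (j + 1) ∈ E.zdArcB → x + cornerUnit (j + 2) ∈ E.zdArcB → ∀ (ω : BondConfig (Site 2)) (t : ℕ), t < exitTime hE ω → cornerOrbit (E.bcBondConfig ω) (startCorner hE) t = (x, j) → Complex.exp (-(Real.pi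 / 6 * turnCount (E.bcBondConfig ω) (startCorner hE) t : ℝ) * I) * I ^ (j : ℕ) * Complex.exp (((-(Real.pi / 6) : ℝ) : ℂ) * I) = d) → ((discreteDomainGraph E.Ω E.δ).induce E.zdArcA).Preconnected → ((zdGraph 2).induce E.zdArcB).Preconnected → ∀ (Φ Ψ : Site 2 → ℂ), IsExactPair E δ Φ Ψ → ∀ (f f' : Site 2), f ∈ sideCells E δ p q η → f' ∈ sideCells E δ p q η → proj p q (ctr δ f) ≤ proj p q (ctr δ f') → rayDist d ((((δ ^ ((2:ℝ) / 3) : ℝ) : ℂ)) * (Ψ f' - Ψ f)) ≤ 10 * δ ^ ((2:ℝ) / 3) ∧ 1 / 2 * touchMass E δ p q (proj p q (ctr δ f) + 3 * δ) (proj p q (ctr δ f') - 3 * δ) - 10 * δ ^ ((2:ℝ) / 3) ≤ ((starRingEnd ℂ) d * ((((δ ^ ((2:ℝ) / 3) : ℝ) : ℂ)) * (Ψ f' - Ψ f))).re := by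
  intro c e he α β δ hδ hα E hΩ hEδ hE hgood j X₀ Y₀ hX hY n hn hn' p q Yp Yq η hpX hqX hpY hqY hpq hYp hYq hη hArc d hd hPh
    hA1 hB1 Φ Ψ hP f f' hf hf' hle
  exact dir_low_free_of_chart' he hδ hα hΩ hEδ hE hgood hX hY hn hn' hpX hqX hpY hqY hpq hYp hYq hη hArc hd hPh hA1 hB1 hP
    hf hf' hle

end Summit.CriticalPhenomena.CardyFormulaZ2.Cruxes.ParafermionToSLESixFamilies.PotentialDarbouxPicardDiamond

end
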